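import Summits.KontsevichZagierPeriods.KontsevichZagierPeriods.Theses.KatzTower
import Summits.KontsevichZagierPeriods.KontsevichZagierPeriods.Theorems.InverseLandauTateLiftingBetaHalfPi

/-!
# `BetaHalfPi` (stmt-KontsevichZagierPeriods-11053, route KatzTower) — proof

`[β(1/2,1/2)] ∼ [closed unit disc, 1]` in the Kontsevich–Zagier move calculus: every
one-dimensional representation with domain `(0,1)` and integrand `t^{-1/2} (1 − t)^{-1/2}` on it
is `KZ.Equivalent` to every two-dimensional representation with domain `{x² + y² ≤ 1}` and
integrand `1` on it (`B(1/2,1/2) = π` inside the four moves). It is verbatim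
`Summit.KontsevichZagierPeriods.InverseLandau.tateLifting_betaHalfPi`
(`Theorems/InverseLandauTateLiftingBetaHalfPi.lean`, stub of the line `Sketch` of the crux
`TateLifting`, stmt-KontsevichZagierPeriods-9129, lead c10), itself a packaging of
`BetaCancellationNegative.equivalent_betaHalfRep_piRep`.
-/

namespace Summit.KontsevichZagierPeriods.KatzTower

/-- **`BetaHalfPi`** (route KatzTower, stmt-KontsevichZagierPeriods-11053): a representation
`[(0,1), t^{-1/2}(1−t)^{-1/2}]` is `KZ.Equivalent` to a representation `[{x²+y² ≤ 1}, 1]`.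
Proof: `InverseLandau.tateLifting_betaHalfPi`. [cite: KontsevichZagier2001, §1.1 eq. (1)] -/
theorem betaHalfPi_proof :
    Summit.KontsevichZagierPeriods.KontsevichZagierPeriods.Theses.KatzTower.BetaHalfPi :=
  Summit.KontsevichZagierPeriods.InverseLandau.tateLifting_betaHalfPi

end Summit.KontsevichZagierPeriods.KatzTower
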